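import Summits.AtomisticToContinuum.BoseEinsteinCondensation.Theorems.BECGroundStateSOSPeriodicIRBoundFsumDefs
import Summits.AtomisticToContinuum.BoseEinsteinCondensation.Theorems.BECGroundStateSOSPeriodicIRBoundWFPolar
import Literature.MathematicalPhysics.QuantumManyBody.PeriodicTorusByParts
import HarnessLib

/-!
# Crux `PeriodicIRBound` (stmt-AtomisticToContinuum-3972), line `fsum-phase-pencil`, stub S2
# `stub_phaseConeBlock` — part 4: one periodic integration by parts, `Re B(f, ρ_k†g) = Re⟨f, W_k g⟩ + Re B(ρ_k f, g)`

With the density wave `G_k(X) = ∑ⱼ e_k(xⱼ)` (`ρ_k† =` multiplication by `G_k`) and the kinetic commutator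
`W_k g = [T, ρ_k†] g = ∑ⱼ e_k(xⱼ)(‖k̃‖² g − 2i ∂_{xⱼ·k̃} g)` (`kinCommutator`), for `C¹` periodic `f, g` with finite
potential parts:
`Re B_w(f, G_k g) = Re⟨f, W_k g⟩ + Re B_w(conj(G_k) f, g)` (`formRe_densityWave_mul`, registered by-product sub-goal
`stub_fsumConeIBP`). The potential terms agree pointwise; of the kinetic terms, `∑ conj(∂f)(∂G_k) g` is integrated by
parts on the torus (`integral_cellN_mul_fderiv_apply`), producing `−ΔG_k = ‖k̃‖² G_k` and `−2∇G_k·∇g`.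
-/

noncomputable section

open MeasureTheory Filter
open scoped ENNReal NNReal ComplexConjugate BigOperators

namespace Summit.AtomisticToContinuum.BoseEinsteinCondensation.Cruxes.PeriodicIRBound.FsumPhasePencil

open Literature.MathematicalPhysics.QuantumManyBody.BoseGas
open Summit.AtomisticToContinuum.BoseEinsteinCondensation.Cruxes.PeriodicIRBound.LinearPhFloorWagner.WF

variable {M : ℕ} {L : ℝ}

/-! ## The gradient multiplier `∂_{i,c} G_k = i k̃_c e_k(x_i)` -/

section Gradient

variable (L : ℝ) (k : Fin 3 → ℤ)

/-- `X ↦ e_k(x_i)` is `Lℤ³`-periodic in every particle. [folklore] -/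
theorem cellWave_comp_apply_periodic {L : ℝ} (hL : 0 < L) (k : Fin 3 → ℤ) (i : Fin M) (X : Config M) (j : Fin M)
    (c : Fin 3) : cellWave L k ((X + Pi.single j (EuclideanSpace.single c L) : Config M) i) = cellWave L k (X i) := by
  rw [Pi.add_apply]
  by_cases hij : i = j
  · subst hij
    rw [Pi.single_eq_same, cellWave_periodic hL.ne']
  · rw [Pi.single_eq_of_ne hij, add_zero]

/-- `∂_{i,c}(i k̃_c e_k(x_i)) = (i k̃_c)² e_k(x_i)`. [folklore] -/
theorem fderiv_gradWave (i : Fin M) (c : Fin 3) (X : Config M) :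
    fderiv ℝ (fun Y : Config M => Complex.I * (waveVector L k c : ℂ) * cellWave L k (Y i)) X
        (Pi.single i (EuclideanSpace.single c (1 : ℝ))) =
      Complex.I * (waveVector L k c : ℂ) * (Complex.I * (waveVector L k c : ℂ) * cellWave L k (X i)) := by
  have hk : waveVector L k = (2 * Real.pi / L) • latticeVec 1 k := by
    ext j
    simp only [waveVector_apply, latticeVec, PiLp.smul_apply, smul_eq_mul]
    ring
  rw [fderiv_const_mul_apply' (differentiable_cellWave_comp_apply L k i X),
    fderiv_cellWave_comp_apply_single_single L k i i c X hk, if_pos rfl]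

/-- `∑_c k̃_c² = ‖k̃‖²` in `ℂ`. [folklore] -/
theorem sum_waveVector_sq : ∑ c : Fin 3, ((waveVector L k c : ℂ)) ^ 2 = ((‖waveVector L k‖ ^ 2 : ℝ) : ℂ) := by
  rw [EuclideanSpace.real_norm_sq_eq]
  push_cast
  rfl

/-- `∑_c k̃_c ∂_{i,c} g = ∂_{x_i·k̃} g`. [folklore] -/
theorem sum_waveVector_mul_fderiv (g : Config M → ℂ) (X : Config M) (i : Fin M) :
    ∑ c : Fin 3, (waveVector L k c : ℂ) * fderiv ℝ g X (Pi.single i (EuclideanSpace.single c (1 : ℝ))) =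
      fderiv ℝ g X (Pi.single i (waveVector L k)) := by
  rw [fderiv_apply_single_eq_sum]
  exact Finset.sum_congr rfl fun c _ => (Complex.real_smul).symm

end Gradient

/-! ## The integration by parts, one direction at a time -/

section ByParts

variable {f g : Config M → ℂ}

/-- One direction `(i, c)`: `∫ conj(∂_{i,c}f)·(i k̃_c e_k(x_i) g) = ∫ conj(f)·(k̃_c² e_k(x_i) g − i k̃_c e_k(x_i) ∂_{i,c} g)`
(periodic integration by parts; `f, g ∈ C¹` periodic). [folklore] -/
theorem integral_conj_fderiv_mul_gradWave (hL : 0 < L) (k : Fin 3 → ℤ) (hf : ContDiff ℝ 1 f) (hg : ContDiff ℝ 1 g) (hfper : IsTorusPeriodic L f)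
    (hgper : IsTorusPeriodic L g) (i : Fin M) (c : Fin 3) :
    ∫ X in cellN M L, conj (fderiv ℝ f X (Pi.single i (EuclideanSpace.single c (1 : ℝ)))) *
        (Complex.I * (waveVector L k c : ℂ) * cellWave L k (X i) * g X) =
      ∫ X in cellN M L, conj (f X) * ((waveVector L k c : ℂ) ^ 2 * cellWave L k (X i) * g X -
        Complex.I * (waveVector L k c : ℂ) * cellWave L k (X i) *
          fderiv ℝ g X (Pi.single i (EuclideanSpace.single c (1 : ℝ)))) := by
  have hd : ContDiff ℝ 1 (fun Y : Config M => Complex.I * (waveVector L k c : ℂ) * cellWave L k (Y i)) :=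
    contDiff_const.mul (contDiff_cellWave_comp_apply L k i)
  have hF : ContDiff ℝ 1 (fun Y : Config M => Complex.I * (waveVector L k c : ℂ) * cellWave L k (Y i) * g Y) :=
    hd.mul hg
  have hG : ContDiff ℝ 1 (fun Y => conj (f Y)) := Complex.conjCLE.contDiff.comp hf
  have hFper : ∀ (X : Config M) (j : Fin M) (c' : Fin 3),
      Complex.I * (waveVector L k c : ℂ) * cellWave L k ((X + Pi.single j (EuclideanSpace.single c' L) : Config M) i) *
          g (X + Pi.single j (EuclideanSpace.single c' L)) =
        Complex.I * (waveVector L k c : ℂ) * cellWave L k (X i) * g X := fun X j c' => by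
    rw [cellWave_comp_apply_periodic hL k i X j c', hgper X j c']
  have hGper : ∀ (X : Config M) (j : Fin M) (c' : Fin 3),
      conj (f (X + Pi.single j (EuclideanSpace.single c' L))) = conj (f X) := fun X j c' => by rw [hfper X j c']
  have h := integral_cellN_mul_fderiv_apply hL hF hG hFper hGper (Pi.single i (EuclideanSpace.single c (1 : ℝ)))
  have hf' := hf.differentiable one_ne_zero
  have hg' := hg.differentiable one_ne_zero
  have hd' := hd.differentiable one_ne_zero
  have hdF : ∀ X, fderiv ℝ (fun Y : Config M => Complex.I * (waveVector L k c : ℂ) * cellWave L k (Y i) * g Y) X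
      (Pi.single i (EuclideanSpace.single c (1 : ℝ))) =
      Complex.I * (waveVector L k c : ℂ) * (Complex.I * (waveVector L k c : ℂ) * cellWave L k (X i)) * g X +
        Complex.I * (waveVector L k c : ℂ) * cellWave L k (X i) *
          fderiv ℝ g X (Pi.single i (EuclideanSpace.single c (1 : ℝ))) := fun X => by
    rw [fderiv_mul_apply (hd' X) (hg' X), fderiv_gradWave]
  simp_rw [fderiv_conj_apply (hf' _), hdF] at h
  calc ∫ X in cellN M L, conj (fderiv ℝ f X (Pi.single i (EuclideanSpace.single c (1 : ℝ)))) *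
        (Complex.I * (waveVector L k c : ℂ) * cellWave L k (X i) * g X)
      = ∫ X in cellN M L, Complex.I * (waveVector L k c : ℂ) * cellWave L k (X i) * g X *
          conj (fderiv ℝ f X (Pi.single i (EuclideanSpace.single c (1 : ℝ)))) :=
        integral_congr_ae (Eventually.of_forall fun X => mul_comm _ _)
    _ = _ := h
    _ = _ := by
        rw [← integral_neg]
        refine integral_congr_ae (Eventually.of_forall fun X => ?_)
        linear_combination (-((waveVector L k c : ℂ)) ^ 2 * cellWave L k (X i) * g X * conj (f X)) *
          Complex.I_mul_I

/-- One particle `i`, summed over the axes: `∑_c ∫ [conj(∂_{i,c}f)(i k̃_c e_k(x_i) g) − i k̃_c e_k(x_i) conj(f) ∂_{i,c}g]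
= ∫ conj(f) e_k(x_i) (‖k̃‖² g − 2i ∂_{x_i·k̃} g)`. [folklore] -/
theorem sum_integral_gradWave (hL : 0 < L) (k : Fin 3 → ℤ) (hf : ContDiff ℝ 1 f) (hg : ContDiff ℝ 1 g) (hfper : IsTorusPeriodic L f)
    (hgper : IsTorusPeriodic L g) (i : Fin M) :
    ∑ c : Fin 3, ∫ X in cellN M L,
        (conj (fderiv ℝ f X (Pi.single i (EuclideanSpace.single c (1 : ℝ)))) *
            (Complex.I * (waveVector L k c : ℂ) * cellWave L k (X i) * g X) -
          Complex.I * (waveVector L k c : ℂ) * cellWave L k (X i) * conj (f X) *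
            fderiv ℝ g X (Pi.single i (EuclideanSpace.single c (1 : ℝ)))) =
      ∫ X in cellN M L, conj (f X) * (cellWave L k (X i) *
        ((((‖waveVector L k‖ ^ 2 : ℝ)) : ℂ) * g X - 2 * Complex.I * fderiv ℝ g X (Pi.single i (waveVector L k)))) := by
  have hf' := hf.differentiable one_ne_zero
  have hec : Continuous (fun X : Config M => cellWave L k (X i)) := (contDiff_cellWave_comp_apply (n := 0) L k i).continuous
  have hcf : ∀ c : Fin 3, Continuous fun X =>
      fderiv ℝ f X (Pi.single i (EuclideanSpace.single c (1 : ℝ))) := fun c => continuous_fderiv_apply_const hf _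
  have hcg : ∀ c : Fin 3, Continuous fun X =>
      fderiv ℝ g X (Pi.single i (EuclideanSpace.single c (1 : ℝ))) := fun c => continuous_fderiv_apply_const hg _
  -- each summand: two integrable pieces
  have hA : ∀ c : Fin 3, Integrable (fun X => conj (fderiv ℝ f X (Pi.single i (EuclideanSpace.single c (1 : ℝ)))) *
      (Complex.I * (waveVector L k c : ℂ) * cellWave L k (X i) * g X)) (volume.restrict (cellN M L)) := fun c =>
    integrableOn_cellN (((Complex.continuous_conj.comp (hcf c))).mul
      ((continuous_const.mul hec).mul hg.continuous)) L
  have hB : ∀ c : Fin 3, Integrable (fun X => Complex.I * (waveVector L k c : ℂ) * cellWave L k (X i) * conj (f X) *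
      fderiv ℝ g X (Pi.single i (EuclideanSpace.single c (1 : ℝ)))) (volume.restrict (cellN M L)) := fun c =>
    integrableOn_cellN ((((continuous_const.mul hec).mul (Complex.continuous_conj.comp hf.continuous))).mul
      (hcg c)) L
  have hC : ∀ c : Fin 3, Integrable (fun X => conj (f X) * ((waveVector L k c : ℂ) ^ 2 * cellWave L k (X i) * g X -
      Complex.I * (waveVector L k c : ℂ) * cellWave L k (X i) *
        fderiv ℝ g X (Pi.single i (EuclideanSpace.single c (1 : ℝ))))) (volume.restrict (cellN M L)) := fun c =>
    integrableOn_cellN ((Complex.continuous_conj.comp hf.continuous).mul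
      (((continuous_const.mul hec).mul hg.continuous).sub ((continuous_const.mul hec).mul (hcg c)))) L
  have hstep : ∀ c : Fin 3, (∫ X in cellN M L,
      (conj (fderiv ℝ f X (Pi.single i (EuclideanSpace.single c (1 : ℝ)))) *
          (Complex.I * (waveVector L k c : ℂ) * cellWave L k (X i) * g X) -
        Complex.I * (waveVector L k c : ℂ) * cellWave L k (X i) * conj (f X) *
          fderiv ℝ g X (Pi.single i (EuclideanSpace.single c (1 : ℝ))))) =
      ∫ X in cellN M L, conj (f X) * ((waveVector L k c : ℂ) ^ 2 * cellWave L k (X i) * g X -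
        2 * Complex.I * (waveVector L k c : ℂ) * cellWave L k (X i) *
          fderiv ℝ g X (Pi.single i (EuclideanSpace.single c (1 : ℝ)))) := fun c => by
    rw [integral_sub (hA c) (hB c), integral_conj_fderiv_mul_gradWave hL k hf hg hfper hgper i c,
      ← integral_sub (hC c) (hB c)]
    refine integral_congr_ae (Eventually.of_forall fun X => ?_)
    ring
  simp_rw [hstep]
  have hD : ∀ c : Fin 3, Integrable (fun X => conj (f X) * ((waveVector L k c : ℂ) ^ 2 * cellWave L k (X i) * g X -
      2 * Complex.I * (waveVector L k c : ℂ) * cellWave L k (X i) *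
        fderiv ℝ g X (Pi.single i (EuclideanSpace.single c (1 : ℝ))))) (volume.restrict (cellN M L)) := fun c =>
    integrableOn_cellN ((Complex.continuous_conj.comp hf.continuous).mul
      (((continuous_const.mul hec).mul hg.continuous).sub ((continuous_const.mul hec).mul (hcg c)))) L
  rw [← integral_finsetSum _ fun c _ => hD c]
  refine integral_congr_ae (Eventually.of_forall fun X => ?_)
  dsimp only
  rw [← Finset.mul_sum, ← sum_waveVector_sq L k, ← sum_waveVector_mul_fderiv L k g X i]
  simp only [Finset.sum_sub_distrib, Finset.mul_sum, Finset.sum_mul, mul_sub]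
  congr 1
  · exact Finset.sum_congr rfl fun c _ => by ring
  · exact Finset.sum_congr rfl fun c _ => by ring

end ByParts

/-! ## The pointwise kinetic identity and the assembly -/

section Assembly

variable {f g : Config M → ℂ}

/-- Pointwise: `kinCross f (G_k g) − kinCross (conj(G_k) f) g = Re ∑_{i,c} [conj(∂f)(∂G_k) g − (∂G_k) conj(f) ∂g]`.
[folklore] -/
theorem kinCross_densityWave_sub (k : Fin 3 → ℤ) {X : Config M} (hf : DifferentiableAt ℝ f X) (hg : DifferentiableAt ℝ g X) :
    kinCross f (fun Y => (∑ j, cellWave L k (Y j)) * g Y) X -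
        kinCross (fun Y => conj (∑ j, cellWave L k (Y j)) * f Y) g X =
      (∑ i : Fin M, ∑ c : Fin 3,
        (conj (fderiv ℝ f X (Pi.single i (EuclideanSpace.single c (1 : ℝ)))) *
            (Complex.I * (waveVector L k c : ℂ) * cellWave L k (X i) * g X) -
          Complex.I * (waveVector L k c : ℂ) * cellWave L k (X i) * conj (f X) *
            fderiv ℝ g X (Pi.single i (EuclideanSpace.single c (1 : ℝ))))).re := by
  have hk : waveVector L k = (2 * Real.pi / L) • latticeVec 1 k := by
    ext j
    simp only [waveVector_apply, latticeVec, PiLp.smul_apply, smul_eq_mul]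
    ring
  have hG : DifferentiableAt ℝ (fun Y : Config M => ∑ j, cellWave L k (Y j)) X :=
    ((ContDiff.sum fun j _ => contDiff_cellWave_comp_apply (n := 1) L k j).differentiable one_ne_zero) X
  have hGrad : ∀ (i : Fin M) (c : Fin 3),
      fderiv ℝ (fun Y : Config M => ∑ j, cellWave L k (Y j)) X (Pi.single i (EuclideanSpace.single c (1 : ℝ))) =
        Complex.I * (waveVector L k c : ℂ) * cellWave L k (X i) := fun i c => by
    rw [fderiv_finset_sum_apply _ (fun j _ => differentiable_cellWave_comp_apply L k j X)]
    simp_rw [fderiv_cellWave_comp_apply_single_single L k _ i c X hk]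
    rw [Finset.sum_ite_eq' Finset.univ i, if_pos (Finset.mem_univ i)]
  have hGc : DifferentiableAt ℝ (fun Y : Config M => conj (∑ j, cellWave L k (Y j))) X :=
    (Complex.conjCLE.differentiable.differentiableAt).comp X hG
  unfold kinCross
  rw [Complex.re_sum, ← Finset.sum_sub_distrib]
  refine Finset.sum_congr rfl fun i _ => ?_
  rw [Complex.re_sum, ← Finset.sum_sub_distrib]
  refine Finset.sum_congr rfl fun c _ => ?_
  rw [fderiv_mul_apply hG hg, fderiv_mul_apply hGc hf, fderiv_conj_apply hG, hGrad, ← Complex.sub_re]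
  congr 1
  simp only [map_add, map_mul, map_neg, neg_neg, Complex.conj_conj, Complex.conj_I, Complex.conj_ofReal]
  ring

/-- The kinetic part of the identity: `∫ kinCross f (G_k g) − ∫ kinCross (conj(G_k) f) g = Re⟨f, W_k g⟩`
for `C¹` periodic `f, g`. [folklore] -/
theorem integral_kinCross_densityWave_sub (hL : 0 < L) (k : Fin 3 → ℤ) (hf : ContDiff ℝ 1 f) (hg : ContDiff ℝ 1 g) (hfper : IsTorusPeriodic L f)
    (hgper : IsTorusPeriodic L g) :
    (∫ X in cellN M L, kinCross f (fun Y => (∑ j, cellWave L k (Y j)) * g Y) X) -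
        ∫ X in cellN M L, kinCross (fun Y => conj (∑ j, cellWave L k (Y j)) * f Y) g X =
      innerRe L f (kinCommutator L k g) := by
  have hGd : ContDiff ℝ 1 (fun Y : Config M => ∑ j, cellWave L k (Y j)) :=
    ContDiff.sum fun j _ => contDiff_cellWave_comp_apply L k j
  have hGcd : ContDiff ℝ 1 (fun Y : Config M => conj (∑ j, cellWave L k (Y j))) := Complex.conjCLE.contDiff.comp hGd
  have hf' := hf.differentiable one_ne_zero
  have hg' := hg.differentiable one_ne_zero
  have hec : ∀ i : Fin M, Continuous (fun X : Config M => cellWave L k (X i)) := fun i =>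
    (contDiff_cellWave_comp_apply (n := 0) L k i).continuous
  have hcf : ∀ (i : Fin M) (c : Fin 3), Continuous fun X =>
      fderiv ℝ f X (Pi.single i (EuclideanSpace.single c (1 : ℝ))) := fun i c => continuous_fderiv_apply_const hf _
  have hcg : ∀ (i : Fin M) (c : Fin 3), Continuous fun X =>
      fderiv ℝ g X (Pi.single i (EuclideanSpace.single c (1 : ℝ))) := fun i c => continuous_fderiv_apply_const hg _
  -- the summands `D_{i,c}`
  have hDc : ∀ (i : Fin M) (c : Fin 3), Continuous fun X =>
      conj (fderiv ℝ f X (Pi.single i (EuclideanSpace.single c (1 : ℝ)))) *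
          (Complex.I * (waveVector L k c : ℂ) * cellWave L k (X i) * g X) -
        Complex.I * (waveVector L k c : ℂ) * cellWave L k (X i) * conj (f X) *
          fderiv ℝ g X (Pi.single i (EuclideanSpace.single c (1 : ℝ))) := fun i c =>
    ((Complex.continuous_conj.comp (hcf i c)).mul ((continuous_const.mul (hec i)).mul hg.continuous)).sub
      (((continuous_const.mul (hec i)).mul (Complex.continuous_conj.comp hf.continuous)).mul (hcg i c))
  rw [← integral_sub (integrableOn_cellN (continuous_kinCross hf (hGd.mul hg)) L)
    (integrableOn_cellN (continuous_kinCross (hGcd.mul hf) hg) L)]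
  simp_rw [kinCross_densityWave_sub k (hf' _) (hg' _)]
  have hI : Integrable (fun X => ∑ i : Fin M, ∑ c : Fin 3,
      (conj (fderiv ℝ f X (Pi.single i (EuclideanSpace.single c (1 : ℝ)))) *
          (Complex.I * (waveVector L k c : ℂ) * cellWave L k (X i) * g X) -
        Complex.I * (waveVector L k c : ℂ) * cellWave L k (X i) * conj (f X) *
          fderiv ℝ g X (Pi.single i (EuclideanSpace.single c (1 : ℝ))))) (volume.restrict (cellN M L)) :=
    integrableOn_cellN (continuous_finsetSum _ fun i _ => continuous_finsetSum _ fun c _ => hDc i c) L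
  have h1 := integral_re hI
  simp only [RCLike.re_to_complex] at h1
  rw [h1, integral_finsetSum _ fun i _ => integrableOn_cellN (continuous_finsetSum _ fun c _ => hDc i c) L]
  simp_rw [integral_finsetSum _ fun c _ => integrableOn_cellN (hDc _ c) L]
  simp_rw [sum_integral_gradWave hL k hf hg hfper hgper]
  have hE : ∀ i : Fin M, Integrable (fun X => conj (f X) * (cellWave L k (X i) *
      ((((‖waveVector L k‖ ^ 2 : ℝ)) : ℂ) * g X - 2 * Complex.I * fderiv ℝ g X (Pi.single i (waveVector L k)))))
      (volume.restrict (cellN M L)) := fun i =>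
    integrableOn_cellN ((Complex.continuous_conj.comp hf.continuous).mul ((hec i).mul
      ((continuous_const.mul hg.continuous).sub (continuous_const.mul (continuous_fderiv_apply_const hg _))))) L
  rw [← integral_finsetSum _ fun i _ => hE i]
  unfold innerRe kinCommutator
  congr 1
  refine integral_congr_ae (Eventually.of_forall fun X => ?_)
  dsimp only
  rw [Finset.mul_sum]

/-- **`Re B_w(f, G_k g) = Re⟨f, W_k g⟩ + Re B_w(conj(G_k) f, g)`** for `C¹` periodic `f, g` with finite potential
parts (the potential terms agree pointwise, the kinetic ones by one integration by parts). [folklore] -/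
theorem formRe_densityWave_mul (hL : 0 < L) {w : ℝ → ℝ≥0∞} (hw : Measurable w) (k : Fin 3 → ℤ)
    (hf : ContDiff ℝ 1 f) (hg : ContDiff ℝ 1 g) (hfper : IsTorusPeriodic L f) (hgper : IsTorusPeriodic L g)
    (hPf : potForm w L f ≠ ⊤) (hPg : potForm w L g ≠ ⊤)
    (hP₁ : potForm w L (fun Y => (∑ j, cellWave L k (Y j)) * g Y) ≠ ⊤)
    (hP₂ : potForm w L (fun Y => conj (∑ j, cellWave L k (Y j)) * f Y) ≠ ⊤) :
    formRe w L f (fun Y => (∑ j, cellWave L k (Y j)) * g Y) =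
      innerRe L f (kinCommutator L k g) + formRe w L (fun Y => conj (∑ j, cellWave L k (Y j)) * f Y) g := by
  have hGd : ContDiff ℝ 1 (fun Y : Config M => ∑ j, cellWave L k (Y j)) :=
    ContDiff.sum fun j _ => contDiff_cellWave_comp_apply L k j
  have hGcd : ContDiff ℝ 1 (fun Y : Config M => conj (∑ j, cellWave L k (Y j))) := Complex.conjCLE.contDiff.comp hGd
  rw [formRe_eq_integral_add hw hf (hGd.mul hg) hPf hP₁, formRe_eq_integral_add hw (hGcd.mul hf) hg hP₂ hPg,
    ← integral_kinCross_densityWave_sub hL k hf hg hfper hgper]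
  have hpot : (∫ X in cellN M L, (periodicInteraction w L X).toReal *
      (conj (f X) * ((∑ j, cellWave L k (X j)) * g X)).re) =
      ∫ X in cellN M L, (periodicInteraction w L X).toReal *
        (conj (conj (∑ j, cellWave L k (X j)) * f X) * g X).re := by
    refine integral_congr_ae (Eventually.of_forall fun X => ?_)
    simp only [map_mul, Complex.conj_conj]
    ring_nf
  rw [hpot]
  ring

/-- **Registered by-product sub-goal `stub_fsumConeIBP`** (line `fsum-phase-pencil`, helper of S2
`stub_phaseConeBlock`): the integration-by-parts identity `formRe_densityWave_mul`. [folklore] -/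
theorem stub_fsumConeIBP : ∀ {M : ℕ} {L : ℝ}, 0 < L → ∀ {w : ℝ → ℝ≥0∞}, Measurable w → ∀ (k : Fin 3 → ℤ) {f g : Config M → ℂ}, ContDiff ℝ 1 f → ContDiff ℝ 1 g → IsTorusPeriodic L f → IsTorusPeriodic L g → potForm w L f ≠ ⊤ → potForm w L g ≠ ⊤ → potForm w L (fun Y => (∑ j, cellWave L k (Y j)) * g Y) ≠ ⊤ → potForm w L (fun Y => conj (∑ j, cellWave L k (Y j)) * f Y) ≠ ⊤ → formRe w L f (fun Y => (∑ j, cellWave L k (Y j)) * g Y) = innerRe L f (kinCommutator L k g) + formRe w L (fun Y => conj (∑ j, cellWave L k (Y j)) * f Y) g :=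
  fun hL _ hw k _ _ hf hg hfper hgper hPf hPg hP₁ hP₂ =>
    formRe_densityWave_mul hL hw k hf hg hfper hgper hPf hPg hP₁ hP₂

end Assembly

end Summit.AtomisticToContinuum.BoseEinsteinCondensation.Cruxes.PeriodicIRBound.FsumPhasePencil

end
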